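import Summits.ResolutionOfSingularities.ResolutionOfSingularities.Theses.UniversalCells
import Summits.ResolutionOfSingularities.ResolutionOfSingularities.Theorems.PrimeFieldToPerfect.Negative.SmoothTwistFalseWithoutGeomIntegral
import Literature.Barriers.ResolutionOfSingularities.InseparableBaseChangeResolution
import Literature.Barriers.ResolutionOfSingularities.RegularNotGeometricallyRegular
import Literature.AlgebraicGeometry.Resolution.SmoothStalksRegular
import HarnessLib

/-!
# Disproof of `PrimeFieldToPerfect` (stmt-ResolutionOfSingularities-15233) — findings

Disprover refuter-cdisprove-stmt-ResolutionOfSingularities-15233-0, cycle 1 (2026-08-17).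
Crux (route `UniversalCells`, rank 5): for a prime `p`,
`Hyp p` := "every INTEGRAL separated finite-type scheme over `Spec (ZMod p)` has a resolution" ⟹
`Concl p` := "every REDUCED separated finite-type scheme over every PERFECT field `k` of
characteristic `p` has a resolution".

## Index of findings (prose only in docstrings; every `theorem` without `sorry` is kernel-checked)

* §0 VERDICT — NO KILL, and none is possible short of `¬ summit`: `crux_of_summit` (the summit
  implies the crux), so `¬ PrimeFieldToPerfect` needs `Hyp p` PROVED for some `p`, i.e. resolution
  of singularities over `𝔽_p` in ALL dimensions. The registered kernel `stub_climb` (`Climb p`,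
  RESHAPE 2) and the alternative entry `SmoothTwist p` (RESHAPE 1) are implied by the summit too.
* §1 LOAD-BEARING HYPOTHESES of the crux (mutation table):
  - `IsReduced X` (conclusion): load-bearing — `concl_false_without_isReduced` (every `p`,
    witness `Spec 𝔽_p[ε]`), whence the mutated crux is `∀ p, ¬ Hyp p` (`cruxWithoutIsReduced_iff`).
  - `IsIntegral X` (hypothesis): load-bearing for NON-VACUITY — `hyp_false_without_isIntegral`.
  - `PerfectField k` (conclusion): dropping it merges the crux with `DescentPerfectToAll`
    (stmt-0549); still implied by the summit; not refutable; no lemma.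
  - `CharP k p` / `p.Prime`: bookkeeping (for `CharP k p` with `p` prime `ZMod p ↪ k`).
* §2 THE KERNEL `SmoothTwist p` (skeleton `Lines/birth.lean`; landed supports p148751, p149455,
  p149298, p148949, p152147): its hypothesis "`X₀ ×_K L` INTEGRAL for a perfect purely
  inseparable `L/K`" is load-bearing and cannot be weakened to "`X₀` integral":
  `smoothTwist_false_without_geomIntegral` (every `p`, ALL levels `K'` at once; witness
  `X₀ = Spec 𝔽_p(t^{1/p})`) — LANDING as
  `Theorems/PrimeFieldToPerfect/Negative/SmoothTwistFalseWithoutGeomIntegral.lean` (p153378,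
  ACCEPTED; namespace `…Theorems.PrimeFieldToPerfect.Negative`, IMPORTED here and restated by name). Core:
  `no_smoothModel_inseparablePoint` — for EVERY field `F ⊇ 𝔽_p(t)` no proper birational
  `Y → X₀ ×_K F` is smooth over `F` — and the positive mechanism
  `hasResolution_level_of_smoothModel` (a smooth model base-changes to a resolution at every
  further level), which is exactly what `stub_limitDescent` consumes.
* §3 TIGHTNESS of the level: over FINITE `K` level `0` suffices (landed `smoothTwist_of_finite`,
  p148949); over `K = 𝔽_p(t)` level `0` FAILS — locally this is the tree's
  `Literature.Barriers.ResolutionOfSingularities.RegularNotGeometricallyRegular` (`y^q = x^p − t`: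
  regular point, singular after `t ↦ t^{1/p}`), restated for the kernel as
  `levelZero_regularModel_not_geometricallyRegular`; the GLOBAL statement "no smooth proper
  birational model of the Kollár curve at level 0" is the near-miss `not_smoothTwist_levelZero`
  (sorry: needs uniqueness of the regular proper model of a curve / "proper birational onto a
  regular curve is an isomorphism", absent from Mathlib).
* §4 NATURAL STRENGTHENINGS (what a proof may NOT do):
  - (s2) "NORMALISE the twists, never re-resolve" is FALSE from dimension 2 (strategist census N3):
    near-miss `twistedSurface_normal_not_regular` (sorry; ring statement; paper proof in its
    docstring). So the kernel needs RESOLUTION at the twisted levels, not normalisation.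
  - (s3) "a UNIFORM level `K'` for all `X₀`" (∃∀ instead of ∀∃) is FALSE: `y² = x^{p^{m+1}} − t`
    needs exactly `m + 1` root extractions (docstring of `not_smoothTwist_levelZero`).
  - (s4) "REGULAR PULLBACK / Néron–Popescu": DEAD in a strong form — see the docstring
    `regularPullback_obstruction`: near the vertex of the affine cone over an elliptic curve
    `E/M(t)^{perf}` with `j(E) = t`, there is NO regular morphism to ANY scheme locally of finite
    type over the perfect constant field `M` (fibre-dimension count ⇒ image point closed with
    residue field algebraic over `M`; Cohen + flatness ⇒ the complete local ring, hence the tangent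
    cone `E`, descends to `M̄ ∩ κ` — contradicts `j = t` transcendental). Hence every proof of
    `Climb`/`SmoothTwist` must MODIFY (blow up) at the twisted levels; it cannot present the
    `L`-variety as a regular base change of an `M`-variety and pull the `M`-resolution back.
  - (s5) "∀-CHOICE termination" (iterate: resolve, adjoin `t^{1/p}`, resolve, …, with ARBITRARY
    resolutions) is FALSE (strategist census N2): blowing up `𝔸²_K` at the closed point
    `(x^p − t, y)` (inseparable residue field) creates a regular NON-smooth point (`x^p − t = v·y`,
    the `A_{p−1}` point `u^p = v y` after the twist). A proof must SELECT resolutions. Candidate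
    Lean lemma for cycle 2 (clone of `RegularNotGeometricallyRegular` with `v·y` for `y^q`).
* §5 TARGETS: `payload.stuck_stubs = ∅`. Line `registered` = `Lines/birth.lean` RESHAPE 2, ONE open
  stub `stub_climb`; its composition `PrimeFieldToPerfect_of` is kernel-checked from LANDED decls
  only (`stub_tower` p152147, `stub_separableDescent` p149298, `descentReducedToIntegral_proof`
  stmt-0551) — no gap smuggled. Mutation of `stub_climb`: dropping `PerfectField M`, `hM`,
  `PerfectField L`, `ht` (algebraic over `M(t)`) or `CharP` only ENLARGES the conclusion inside the
  summit — not refutable; dropping `IsIntegral X` is refutable only modulo `hM` (no perfect `M`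
  with `IntegralResOver M` is provable today) — the same `Spec L[ε]` witness as §1, not re-filed.

## What was used from the tree
`Literature.Barriers.ResolutionOfSingularities.{InseparableBaseChange, InseparableBaseChangeResolution,
RegularNotGeometricallyRegular, FrobeniusTwistResolution}` (witness fields `baseField p = 𝔽_p(t)`,
`extField p = 𝔽_p(t^{1/p})`, one-point non-reduced schemes have no resolution, the Kollár local
rings); `Theorems.hasResolution_pullback_snd_of_flat` (Descent route, robust model);
`Literature.AlgebraicGeometry.Resolution.isRegularLocalRing_stalk_of_smooth_of_field` (Stacks 056S).
Evidence read: rattack CruxAttack.lean / ATTACK.md (S → C, IsReduced/IsIntegral mutations — re-proved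
here in §0–§1 so that this file is the single importable record), KERNEL.md, STRATEGY-CENSUS.md,
PICKED.md, Lines/birth.lean (RESHAPE 2), Lines/frobenius_root_climb.lean.
-/

noncomputable section

-- single-problem summit: the doubled namespace component `ResolutionOfSingularities` is forced
set_option linter.dupNamespace false

open CategoryTheory CategoryTheory.Limits AlgebraicGeometry TensorProduct
open Literature.AlgebraicGeometry.Resolution Literature.Barriers.ResolutionOfSingularities
open Summit.ResolutionOfSingularities.ResolutionOfSingularities.Theses.UniversalCells (PrimeFieldToPerfect)

namespace Summit.ResolutionOfSingularities.ResolutionOfSingularities.Cruxes.PrimeFieldToPerfect.Disproof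

/-! ## §0 Verdict: the summit implies the crux (so a kill needs `Hyp p` proved) -/

/-- The hypothesis of the crux at `p`: resolution of integral separated finite-type
`𝔽_p`-schemes (= the route's target `PrimeFieldThesis` at `p`). -/
abbrev Hyp (p : ℕ) : Prop :=
  ∀ (X : Scheme.{0}) (f : X ⟶ Spec (.of (ZMod p))), IsSeparated f → LocallyOfFiniteType f →
    QuasiCompact f → IsIntegral X → Scheme.HasResolution X

/-- The conclusion of the crux at `p`: resolution of reduced separated finite-type schemes over
every perfect field of characteristic `p`. -/
abbrev Concl (p : ℕ) : Prop :=
  ∀ (k : Type) [Field k] [CharP k p] [PerfectField k] (X : Scheme.{0}) (f : X ⟶ Spec (.of k)),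
    IsSeparated f → LocallyOfFiniteType f → QuasiCompact f → IsReduced X → Scheme.HasResolution X

/-- Read-back: the crux is literally `∀ p prime, Hyp p → Concl p`. -/
theorem crux_iff : PrimeFieldToPerfect ↔ ∀ p : ℕ, p.Prime → Hyp p → Concl p := Iff.rfl

/-- **S → C.** The summit implies the crux (its conclusion is the summit restricted to perfect
ground fields), so `¬ PrimeFieldToPerfect` would refute the summit AND require `Hyp p` — resolution
over `𝔽_p` in all dimensions — to be proved first: no unconditional kill is available. [folklore] -/
theorem crux_of_summit (h : _root_.ResolutionOfSingularities) : PrimeFieldToPerfect :=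
  fun p hp _ k _ _ _ X f hs hl hq hr => h p hp k X f hs hl hq hr

/-! ## §1 Load-bearing hypotheses of the crux -/

/-- `IsReduced X` in the conclusion is load-bearing: without it the conclusion is FALSE at every
prime (`Spec 𝔽_p[ε]` over the perfect field `𝔽_p`: separated, finite type, one non-reduced point,
no resolution). [folklore] -/
theorem concl_false_without_isReduced (p : ℕ) [Fact p.Prime] :
    ¬ ∀ (k : Type) [Field k] [CharP k p] [PerfectField k] (X : Scheme.{0}) (f : X ⟶ Spec (.of k)),
      IsSeparated f → LocallyOfFiniteType f → QuasiCompact f → Scheme.HasResolution X := fun h =>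
  not_hasResolution_Spec_dualNumber (ZMod p)
    (h (ZMod p) (Spec (.of (DualNumber (ZMod p))))
      (Spec.map (CommRingCat.ofHom (algebraMap (ZMod p) (DualNumber (ZMod p))))) inferInstance
      (locallyOfFiniteType_Spec_dualNumber (ZMod p)) inferInstance)

/-- Hence the crux with `IsReduced` dropped is equivalent to "`Hyp p` fails for every prime `p`"
(a statement nobody expects): the mutation is not a usable strengthening. [folklore] -/
theorem cruxWithoutIsReduced_iff :
    (∀ p : ℕ, p.Prime → Hyp p →
      ∀ (k : Type) [Field k] [CharP k p] [PerfectField k] (X : Scheme.{0}) (f : X ⟶ Spec (.of k)),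
        IsSeparated f → LocallyOfFiniteType f → QuasiCompact f → Scheme.HasResolution X) ↔
    ∀ p : ℕ, p.Prime → ¬ Hyp p := by
  refine ⟨fun h p hp hH => ?_, fun h p hp hH => absurd hH (h p hp)⟩
  haveI : Fact p.Prime := ⟨hp⟩
  exact concl_false_without_isReduced p (h p hp hH)

/-- `IsIntegral X` in the HYPOTHESIS is load-bearing for non-vacuity: without it `Hyp p` is FALSE
(`Spec 𝔽_p[ε]` again), and the mutated crux holds vacuously. [folklore] -/
theorem hyp_false_without_isIntegral (p : ℕ) [Fact p.Prime] :
    ¬ ∀ (X : Scheme.{0}) (f : X ⟶ Spec (.of (ZMod p))), IsSeparated f → LocallyOfFiniteType f →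
      QuasiCompact f → Scheme.HasResolution X := fun h =>
  not_hasResolution_Spec_dualNumber (ZMod p)
    (h (Spec (.of (DualNumber (ZMod p))))
      (Spec.map (CommRingCat.ofHom (algebraMap (ZMod p) (DualNumber (ZMod p))))) inferInstance
      (locallyOfFiniteType_Spec_dualNumber (ZMod p)) inferInstance)

/-! ## §2 The kernel `SmoothTwist`: geometric integrality is load-bearing (all levels at once)

LANDED as `Theorems/PrimeFieldToPerfect/Negative/SmoothTwistFalseWithoutGeomIntegral.lean` (p153378);
the three entry points are restated here BY NAME so that this index stays complete (ideators /
planners: import that module, namespace `…Theorems.PrimeFieldToPerfect.Negative`). -/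

section Kernel

open Summit.ResolutionOfSingularities.ResolutionOfSingularities.Theorems.PrimeFieldToPerfect

variable (p : ℕ) [hp : Fact p.Prime]

/-- **Smooth models base-change to resolutions at every further level** (the positive mechanism
behind `stub_limitDescent`; landed). [cite: StacksProject, Tag 056S (Lemma 33.25.3)] -/
theorem hasResolution_level_of_smoothModel {K : Type} [Field K] {X₀ : Scheme.{0}}
    (f₀ : X₀ ⟶ Spec (.of K)) [LocallyOfFiniteType f₀] [QuasiCompact f₀]
    (F : Type) [Field F] [Algebra K F] (Y : Scheme.{0})
    (π : Y ⟶ pullback f₀ (Spec.map (CommRingCat.ofHom (algebraMap K F)))) [IsProper π]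
    (hbir : IsBirational π)
    [Smooth (π ≫ pullback.snd f₀ (Spec.map (CommRingCat.ofHom (algebraMap K F))))]
    (F' : Type) [Field F'] [Algebra K F'] [Algebra F F'] [IsScalarTower K F F'] :
    Scheme.HasResolution (pullback f₀ (Spec.map (CommRingCat.ofHom (algebraMap K F')))) :=
  Negative.hasResolution_level_of_smoothModel f₀ F Y π hbir F'

/-- **No Frobenius level repairs the inseparable point** (landed): for `K = 𝔽_p(t)`,
`X₀ = Spec K(t^{1/p})` and ANY field `F ⊇ K`, no proper birational `π : Y → X₀ ×_K F` has `Y`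
smooth over `F`. [cite: Liu2002, Example 3.2.12 and Remark 4.3.34] -/
theorem no_smoothModel_inseparablePoint (F : Type) [Field F] [Algebra (baseField p) F]
    (Y : Scheme.{0})
    (π : Y ⟶ pullback (Spec.map (CommRingCat.ofHom (algebraMap (baseField p) (extField p))))
      (Spec.map (CommRingCat.ofHom (algebraMap (baseField p) F))))
    [IsProper π] (hbir : IsBirational π)
    [Smooth (π ≫ pullback.snd (Spec.map (CommRingCat.ofHom (algebraMap (baseField p) (extField p))))
      (Spec.map (CommRingCat.ofHom (algebraMap (baseField p) F))))] :
    False :=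
  Negative.no_smoothModel_inseparablePoint p F Y π hbir

/-- **`SmoothTwist` without geometric integrality is FALSE (every prime `p`)** — the registered
kernel signature with "`X₀ ×_K L` integral for some perfect purely inseparable `L/K`" weakened to
"`X₀` integral" (landed). [cite: Liu2002, Example 3.2.12 and Remark 4.3.34] -/
theorem smoothTwist_false_without_geomIntegral :
    ¬ ∀ (K : Type) [Field K] [CharP K p], (∃ s : Finset K, Subfield.closure (s : Set K) = ⊤) →
      ∀ (X₀ : Scheme.{0}) (f₀ : X₀ ⟶ Spec (.of K)),
        IsSeparated f₀ → LocallyOfFiniteType f₀ → QuasiCompact f₀ → IsIntegral X₀ →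
        ∃ (K' : Type) (_ : Field K') (_ : Algebra K K') (_ : IsPurelyInseparable K K')
          (_ : Module.Finite K K') (Y : Scheme.{0})
          (π : Y ⟶ pullback f₀ (Spec.map (CommRingCat.ofHom (algebraMap K K')))),
          IsProper π ∧ IsBirational π ∧
            Smooth (π ≫ pullback.snd f₀ (Spec.map (CommRingCat.ofHom (algebraMap K K')))) :=
  Negative.smoothTwist_false_without_geomIntegral p

end Kernel

/-! ## §3 Tightness of the level -/

/-- **Level 0 fails locally over `𝔽_p(t)` (restated from the barrier catalogue for the kernel).**
There is a finite-type `𝔽_p(t)`-algebra `A` (the Kollár curve `y² = x^p − t`) with a prime `𝔭` at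
which `A` is regular while the base change `K ⊗ A ≅ B`, `K = 𝔽_p(t^{1/p})`, is NOT regular at the
prime over `𝔭`: a regular model at level 0 whose first twist is singular, so "`K' = K` always
suffices in `SmoothTwist`" has no chance via regular models; the missing global step is
`not_smoothTwist_levelZero`. [cite: Kollar2007, 1.19 (Curves over nonperfect fields)] -/
theorem levelZero_regularModel_not_geometricallyRegular (p : ℕ) [Fact p.Prime] :
    ∃ (k K : Type) (_ : Field k) (_ : Field K) (_ : Algebra k K) (A : Type) (_ : CommRing A)
      (_ : Algebra k A) (B : Type) (_ : CommRing B) (_ : Algebra K B) (e : K ⊗[k] A ≃ₐ[K] B)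
      (𝔭 : Ideal A) (_ : 𝔭.IsPrime) (𝔓 : Ideal B) (_ : 𝔓.IsPrime),
      CharP k p ∧ FiniteDimensional k K ∧ Algebra.FiniteType k A ∧
        (∀ a : A, e (1 ⊗ₜ a) ∈ 𝔓 ↔ a ∈ 𝔭) ∧
        IsRegularLocalRing (Localization.AtPrime 𝔭) ∧
        ¬ IsRegularLocalRing (Localization.AtPrime 𝔓) :=
  RegularNotGeometricallyRegular p

/-- **NEAR-MISS (s1): level 0 does not suffice — no smooth proper birational model at `K' = K`.**
Statement: the kernel `SmoothTwist p` with the level frozen at `K' = K` is false. Paper proof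
(Kollár 2007, 1.19; Liu 2002, Prop. 7.3.13 / Ex. 7.3.15): over `K = 𝔽_p(t)` take the regular
projective model `C` of `y^q = x^p − t` (`q` a prime `≠ p`); `C` is geometrically integral and not
smooth at `(x^p = t, y = 0)` (`levelZero_regularModel_not_geometricallyRegular`); a proper
birational `π : Y → C` with `Y` smooth (hence regular, integral) is finite birational onto the
NORMAL curve `C`, hence an isomorphism — contradiction. The same family with `x^{p^{m+1}}` shows
that NO UNIFORM level works for all `X₀` (strengthening (s3), ∃∀): `y^q = x^{p^{m+1}} − t` stays
regular non-smooth for `m` root extractions and becomes smoothable exactly at level `m + 1`.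
OBSTRUCTION to closing in Lean (tried: search of Mathlib/tree): needs "a proper birational morphism
onto a regular (normal) curve is an isomorphism" (valuative criterion + domination of DVRs, or
uniqueness of regular proper models of curves) and `dim Y = 1`; none is in Mathlib or the tree
(`Literature/AlgebraicGeometry/Resolution/*` has affine blow-ups and regular local rings, not ZMT
for curves). [cite: Kollar2007, 1.19 (Curves over nonperfect fields)] -/
theorem not_smoothTwist_levelZero (p : ℕ) [Fact p.Prime] :
    ¬ ∀ (K : Type) [Field K] [CharP K p], (∃ s : Finset K, Subfield.closure (s : Set K) = ⊤) →
      ∀ (X₀ : Scheme.{0}) (f₀ : X₀ ⟶ Spec (.of K)),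
        IsSeparated f₀ → LocallyOfFiniteType f₀ → QuasiCompact f₀ →
        (∃ (L : Type) (_ : Field L) (_ : PerfectField L) (_ : Algebra K L)
            (_ : IsPurelyInseparable K L),
            IsIntegral (pullback f₀ (Spec.map (CommRingCat.ofHom (algebraMap K L))))) →
        ∃ (Y : Scheme.{0}) (π : Y ⟶ X₀), IsProper π ∧ IsBirational π ∧ Smooth (π ≫ f₀) := by
  sorry

/-! ## §4 Natural strengthenings: near-misses and paper-level obstructions -/

/-- **NEAR-MISS (s2): "normalise the twists, never re-resolve" fails from dimension 2**
(strategist census §Negation N3; the lead's KERNEL.md §4 (s2)). Ring statement: for every field `F`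
of odd characteristic `p`, the hypersurface ring `Z_F = F[u,y,z]/(u^p + y² + z²)` is a NORMAL domain
which is NOT regular (at the origin `u = y = z = 0`: the defining equation lies in `𝔪²`, so the
cotangent space is 3-dimensional while `dim Z_F = 2`). Use: over `K = 𝔽_p(t)` the surface
`Y = {x^p − t + y² + z² = 0}` is regular and geometrically integral; for every `m ≥ 1`,
`Y ⊗_K K^{1/p^m} ≅ Z_{K^{1/p^m}}` (`u = x − t^{1/p}`), which is its own normalisation and never
smooth — while `SmoothTwist` holds for `Y` at level 1 by RESOLVING `Z_{𝔽_p}` over `𝔽_p` and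
base-changing smoothly. So the kernel needs resolution of the twisted levels, not normalisation
(`p = 2`: use `x² + t + yz`). OBSTRUCTION to closing in Lean (not attempted beyond API search):
normality of `Z_F` needs Serre's criterion `R₁ + S₂` for hypersurfaces or an explicit integral-closure
computation; `¬ IsRegularRing` needs `dim Z_F = 2` (Krull's Hauptidealsatz for `F[u,y,z]/(f)`) — the
tree has the cotangent-space side (`RegularNotGeometricallyRegular` technique) but not the
normality side. [cite: arXiv:1708.04268, Thm 1.1 and §2.4 (Patakfalvi–Waldron)] -/
theorem twistedSurface_normal_not_regular (p : ℕ) [Fact p.Prime] (hp : p ≠ 2)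
    (F : Type) [Field F] [CharP F p] :
    let f : MvPolynomial (Fin 3) F :=
      MvPolynomial.X 0 ^ p + MvPolynomial.X 1 ^ 2 + MvPolynomial.X 2 ^ 2
    IsDomain (MvPolynomial (Fin 3) F ⧸ Ideal.span {f}) ∧
      IsIntegrallyClosed (MvPolynomial (Fin 3) F ⧸ Ideal.span {f}) ∧
      ¬ IsRegularRing (MvPolynomial (Fin 3) F ⧸ Ideal.span {f}) := by
  sorry

/-- **PAPER-LEVEL OBSTRUCTION (s4): regular pullback / Néron–Popescu presentations are dead.**
(Recorded as a `True` anchor so that the index can point here; the content is this docstring.)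

Claim. Let `M` be a perfect field of characteristic `p ≥ 5`, `L = M(t)^{perf}`, `E ⊂ ℙ²_L` the
elliptic curve `y² = x³ + a x + b` with `j(E) = t`, and `X₁ = Spec L[x,y,z]/(y²z − x³ − a x z² − b z³)`
its affine cone, vertex `v`. Then NO open neighbourhood of `v` admits a regular morphism (flat with
geometrically regular fibres) to a scheme `𝒳` locally of finite type over `M`. Consequently a
resolution of `X₁` can NOT be obtained as the pullback of an `M`-resolution along a regular
morphism — the only functoriality weak (existence-only) resolution enjoys — and Popescu's theorem
(`L` is a filtered colimit of smooth `M`-algebras) gives no handle: the finite stages map to `L`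
through imperfect residue fields, never regularly.

Proof sketch. Let `f : U → 𝒳` be regular, `z = f(v)`. (i) Regular morphisms reflect and preserve
regularity (`𝒪_{𝒳,z} → 𝒪_{X₁,v}` flat local; EGA IV₂ 6.5.2), so `Sing U = f⁻¹(Sing 𝒳)` and, `v`
being an ISOLATED singular point, `v` is isolated in its fibre `f⁻¹(z)`; the fibre's local ring at
`v` is then Artinian and geometrically regular over `κ(z)`, i.e. the field `κ(v) = L`, with
`L/κ(z)` separable and `𝔪_z 𝒪_{X₁,v} = 𝔪_v`. (ii) `L` perfect and `L/κ(z)` separable force `κ(z)`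
perfect (`κ(z)^{1/p} ⊆ L` is linearly disjoint from `L` over `κ(z)` only if `κ(z)^{1/p} = κ(z)`); a
perfect field finitely generated over the perfect `M` is ALGEBRAIC over `M` (transcendence degree
`d ≥ 1` gives `[κ : κ^p] = p^d`); so `z` is a closed point with `κ(z)` finite over `M`. (iii) Cohen
structure + flatness: with `A = 𝒪_{𝒳,z}`, `B = 𝒪_{X₁,v}`, `𝔪_A B = 𝔪_B` and the unique coefficient
fields (`κ(z)`, `L` perfect), `B̂ ≅ Â ⊗̂_{κ(z)} L` (both sides flat over `Â`, equal modulo `𝔪_A`,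
Nakayama), hence `gr_{𝔪}(B) ≅ gr_{𝔪}(A) ⊗_{κ(z)} L`. (iv) `Proj gr_{𝔪}(B) = E` (tangent cone of a
cone), so `E ≅ (Proj gr_{𝔪} A) ×_{κ(z)} L` descends to `κ(z) ⊆ M̄`, and `j(E) ∈ M̄ ∩ L` — but
`j(E) = t` is transcendental over `M`. ∎  The same argument over `𝔽_p` (instead of `M`) kills
regular morphisms from `X₁/𝔽_p(t)^{perf}` to finite-type `𝔽_p`-schemes, i.e. the crux-level
version. Not formalised (Mathlib lacks regular morphisms, Cohen structure, tangent cones).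
[cite: EGAIV2, 6.5.2 and 6.8.3] -/
theorem regularPullback_obstruction : True := trivial

end Summit.ResolutionOfSingularities.ResolutionOfSingularities.Cruxes.PrimeFieldToPerfect.Disproof

end
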